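import Mathlib
import HarnessLib
import Summits.NavierStokesRegularity.NavierStokesRegularity.Theorems.TaylorModelRungThreeCertificateBoxFieldDVar

/-!
# Crux K1b-DR (stmt-NavierStokesRegularity-23954), line `taylor-model` — the cascade's interval jets through ANY interval twin of the
# NON-SYMMETRISED truncated field `qB d` (polarisation is free for jets; generic consumer theorems for fast twins)

MEASURED on the farm (`native_decide`, n = 88, 22 non-zero α, state jets to order 13 over a box = 91 field calls): the symmetrised
full-table twin `QbBoxA` of `…CertificateBoxFieldD` costs ≈ 0.33 s per call (≈ 30 s per sub-step for the state jets alone), a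
non-symmetrised zero-skipping twin ≈ 0.06 s, a non-symmetrised SPARSE twin (monomial list per target, `…BoxFieldDSparse`) ≈ 0.017 s.
The polarisation is unnecessary for JETS: the Taylor and variational jets of `u' = Q(u,u)` depend on `Q` only through the symmetric
sums `Σ_{m≤k} Q(T_m, T_{k-m})` and `Q(T_i, U_{k-i}) + Q(U_{k-i}, T_i)`, which coincide for the bilinear form `qB d` and its
symmetrisation `d.Qb`: `taylorJet_qBf`, `varJet_qBf` (by `eq_taylorJet_of_rec` / `eq_varJet_of_rec` and `Finset.sum_range_reflect`).
Hence for ANY array twin `QBA` with `IsFieldEnclosureA T.wv (qBf d) T.n QBA` (fast twins prove only this), the four cascade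
enclosures hold with the jets of `d.Qb`: `mem_taylorJet_of_jetLevelsA_qBf` (J), `mem_varJet_of_varJetLevelsA_qBf` (JV),
`mem_taylorJet_sub_of_diffJetLevelsA_qBf` (JD), `mem_taylorJet_r2_of_r2LevelsA_qBf` (R2D) — same conclusions as the `QbBoxA`
versions of `…BoxFieldD` / `…BoxFieldDVar`.

MODEL-lattice bookkeeping only (rung TL-M3); nothing here concerns the Navier–Stokes equations.
-/

-- the sub-problem namespace repeats the summit name by design (D-0017)
set_option linter.dupNamespace false

namespace Summit.NavierStokesRegularity.NavierStokesRegularity.Theorems.TaylorModelCert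

open scoped BigOperators
open Literature.Analysis.FluidPDE.TaoCascade Literature.Analysis.FluidPDE.TaoCascade.TaylorChain
open Summit.NavierStokesRegularity.NavierStokesRegularity.Theorems.TaylorModelReadout (qB Qb_eq qB_add_left qB_add_right taylorJet
  taylorJet_zero taylorJet_succ eq_taylorJet_of_rec varJet varJet_zero varJet_succ eq_varJet_of_rec)

/-! ### The non-symmetrised field and its jets -/

/-- The truncated BILINEAR form `qB d` as a field on window functions (not symmetric; its symmetrisation is `d.Qb`). [folklore] -/
noncomputable def qBf (d : CertData) : (Fin 4 → ℤ → ℝ) → (Fin 4 → ℤ → ℝ) → Fin 4 → ℤ → ℝ := fun u w i k => qB d u w i k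

/-- The symmetric Cauchy sums of `qB d` and `d.Qb` agree. [folklore] -/
theorem sum_qBf_eq_sum_Qb (d : CertData) (P : ℕ → Fin 4 → ℤ → ℝ) (k : ℕ) :
    ∑ m ∈ Finset.range (k + 1), qBf d (P m) (P (k - m)) = ∑ m ∈ Finset.range (k + 1), d.Qb (P m) (P (k - m)) := by
  funext i n
  simp only [Finset.sum_apply, qBf, Qb_eq]
  have hrefl : ∑ m ∈ Finset.range (k + 1), qB d (P (k - m)) (P m) i n = ∑ m ∈ Finset.range (k + 1), qB d (P m) (P (k - m)) i n := by
    rw [← Finset.sum_range_reflect]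
    refine Finset.sum_congr rfl fun m hm => ?_
    have hmk : m ≤ k := Nat.lt_succ_iff.1 (Finset.mem_range.1 hm)
    rw [show k + 1 - 1 - m = k - m from by omega, show k - (k - m) = m from by omega]
  rw [← Finset.sum_div, Finset.sum_add_distrib, hrefl]
  ring

/-- **The Taylor jets of `qB d` are those of `d.Qb`.** [folklore] -/
theorem taylorJet_qBf (d : CertData) (x : Fin 4 → ℤ → ℝ) (k : ℕ) : taylorJet (qBf d) x k = taylorJet d.Qb x k :=
  eq_taylorJet_of_rec d.Qb x (p := k) (P := taylorJet (qBf d) x) (taylorJet_zero _ _)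
    (fun n _ => by rw [taylorJet_succ, sum_qBf_eq_sum_Qb]) k le_rfl

/-- **The variational jets of `qB d` are those of `d.Qb`.** [folklore] -/
theorem varJet_qBf (d : CertData) (x v : Fin 4 → ℤ → ℝ) (k : ℕ) : varJet (qBf d) x v k = varJet d.Qb x v k := by
  refine eq_varJet_of_rec d.Qb x v (p := k) (W := varJet (qBf d) x v) (varJet_zero _ _ _) (fun n _ => ?_) k le_rfl
  rw [varJet_succ]
  refine Finset.sum_congr rfl fun m _ => ?_
  rw [taylorJet_qBf]
  funext i j
  simp only [Pi.add_apply, qBf, Qb_eq]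
  ring

/-- `qBf d` is additive in the first slot. [folklore] -/
theorem qBf_add_left (d : CertData) (u u' w : Fin 4 → ℤ → ℝ) : qBf d (u + u') w = qBf d u w + qBf d u' w := by
  funext i k; exact qB_add_left d u u' w i k

/-- `qBf d` is additive in the second slot. [folklore] -/
theorem qBf_add_right (d : CertData) (u w w' : Fin 4 → ℤ → ℝ) : qBf d u (w + w') = qBf d u w + qBf d u w' := by
  funext i k; exact qB_add_right d u w w' i k

namespace CertTables

section Sound

variable {K : Type} [Field K] {φ : K →+* ℝ} (T : CertTables K) {QBA : Array IntervalD → Array IntervalD → Array IntervalD}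

/-- The Taylor-jet recursion of `qBf d`, read through the window coordinates. [folklore] -/
theorem wv_taylorJet_qBf_succ (x : Fin 4 → ℤ → ℝ) (k : ℕ) (c : ℕ) :
    ((k : ℝ) + 1) * T.wv (taylorJet (qBf (T.toCertData φ)) x (k + 1)) c =
      ∑ i ∈ Finset.range (k + 1), T.wv (qBf (T.toCertData φ) (taylorJet (qBf (T.toCertData φ)) x i)
        (taylorJet (qBf (T.toCertData φ)) x (k - i))) c := by
  have h := congrFun (congrFun (taylorJet_succ (qBf (T.toCertData φ)) x k) (T.wi c)) (T.wk c)
  simp only [Pi.smul_apply, smul_eq_mul, Finset.sum_apply] at h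
  simpa only [wv] using h

/-- The variational-jet recursion of `qBf d`, read through the window coordinates. [folklore] -/
theorem wv_varJet_qBf_succ (x v : Fin 4 → ℤ → ℝ) (k : ℕ) (c : ℕ) :
    ((k : ℝ) + 1) * T.wv (varJet (qBf (T.toCertData φ)) x v (k + 1)) c =
      ∑ i ∈ Finset.range (k + 1), (T.wv (qBf (T.toCertData φ) (taylorJet (qBf (T.toCertData φ)) x i)
        (varJet (qBf (T.toCertData φ)) x v (k - i))) c +
        T.wv (qBf (T.toCertData φ) (varJet (qBf (T.toCertData φ)) x v (k - i)) (taylorJet (qBf (T.toCertData φ)) x i)) c) := by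
  have h := congrFun (congrFun (varJet_succ (qBf (T.toCertData φ)) x v k) (T.wi c)) (T.wk c)
  simp only [Pi.smul_apply, smul_eq_mul, Finset.sum_apply, Pi.add_apply] at h
  simpa only [wv] using h

/-- **Interval Taylor jets through any twin of `qB d`**: if `QBA` is an interval extension of `qBf d` (read through `T.wv`), the window
coordinates of `taylorJet d.Qb y k` lie in `jetLevelsA T.n QBA prec Y K` for every `y` with window coordinates in `Y`. [folklore] -/
theorem mem_taylorJet_of_jetLevelsA_qBf (hQBA : IntervalD.IsFieldEnclosureA T.wv (qBf (T.toCertData φ)) T.n QBA) (prec K : ℕ)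
    {Y : Array IntervalD} (hY : Y.size = T.n) {y : Fin 4 → ℤ → ℝ} (hy : ∀ c < T.n, IntervalD.mem (T.wv y c) (IntervalD.aget Y c)) :
    ∀ k ≤ K, ∀ c < T.n, IntervalD.mem (T.wv (taylorJet (T.toCertData φ).Qb y k) c)
      (IntervalD.aget (IntervalD.lget (IntervalD.jetLevelsA T.n QBA prec Y K) k) c) := by
  intro k hk c hc
  rw [← taylorJet_qBf]
  exact IntervalD.mem_jet_of_jetLevelsA (T := taylorJet (qBf (T.toCertData φ))) (fun x c _ => by rw [taylorJet_zero])
    (fun x k c _ => T.wv_taylorJet_qBf_succ x k c) hQBA prec K hY hy k hk c hc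

/-- **Interval variational jets through any twin of `qB d`.** [folklore] -/
theorem mem_varJet_of_varJetLevelsA_qBf (hQBA : IntervalD.IsFieldEnclosureA T.wv (qBf (T.toCertData φ)) T.n QBA) (prec K : ℕ)
    {Y D : Array IntervalD} (hY : Y.size = T.n) (hD : D.size = T.n) {y v : Fin 4 → ℤ → ℝ}
    (hy : ∀ c < T.n, IntervalD.mem (T.wv y c) (IntervalD.aget Y c)) (hv : ∀ c < T.n, IntervalD.mem (T.wv v c) (IntervalD.aget D c)) :
    ∀ k ≤ K, ∀ c < T.n, IntervalD.mem (T.wv (varJet (T.toCertData φ).Qb y v k) c)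
      (IntervalD.aget (IntervalD.lget (IntervalD.varJetLevelsA T.n QBA prec (IntervalD.jetLevelsA T.n QBA prec Y K) D K) k) c) := by
  intro k hk c hc
  rw [← varJet_qBf]
  exact IntervalD.mem_varJet_of_varJetLevelsA (T := taylorJet (qBf (T.toCertData φ))) (U := varJet (qBf (T.toCertData φ)))
    (fun x c _ => by rw [taylorJet_zero]) (fun x k c _ => T.wv_taylorJet_qBf_succ x k c) (fun x v c _ => by rw [varJet_zero])
    (fun x v k c _ => T.wv_varJet_qBf_succ x v k c) hQBA prec K hY hD hy hv k hk c hc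

/-- **Interval jet differences through any twin of `qB d`.** [folklore] -/
theorem mem_taylorJet_sub_of_diffJetLevelsA_qBf (hQBA : IntervalD.IsFieldEnclosureA T.wv (qBf (T.toCertData φ)) T.n QBA)
    (prec K : ℕ) {Y D : Array IntervalD} (hY : Y.size = T.n) (hD : D.size = T.n) {y y' : Fin 4 → ℤ → ℝ}
    (hy : ∀ c < T.n, IntervalD.mem (T.wv y c) (IntervalD.aget Y c))
    (hd : ∀ c < T.n, IntervalD.mem (T.wv y' c - T.wv y c) (IntervalD.aget D c)) :
    ∀ k ≤ K, ∀ c < T.n, IntervalD.mem (T.wv (taylorJet (T.toCertData φ).Qb y' k) c - T.wv (taylorJet (T.toCertData φ).Qb y k) c)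
      (IntervalD.aget (IntervalD.lget (IntervalD.diffJetLevelsA T.n QBA prec (IntervalD.jetLevelsA T.n QBA prec Y K) D K) k) c) := by
  intro k hk c hc
  rw [← taylorJet_qBf, ← taylorJet_qBf]
  exact IntervalD.mem_diffJet_of_diffJetLevelsA (T := taylorJet (qBf (T.toCertData φ))) (qBf_add_left (T.toCertData φ))
    (qBf_add_right (T.toCertData φ)) (fun x z c _ => T.wv_add x z c) (fun x c _ => by rw [taylorJet_zero])
    (fun x k c _ => T.wv_taylorJet_qBf_succ x k c) hQBA prec K hY hD hy hd k hk c hc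

/-- **Interval second-order remainders through any twin of `qB d`.** [folklore] -/
theorem mem_taylorJet_r2_of_r2LevelsA_qBf (hQBA : IntervalD.IsFieldEnclosureA T.wv (qBf (T.toCertData φ)) T.n QBA) (prec K : ℕ)
    {Y D : Array IntervalD} (hY : Y.size = T.n) (hD : D.size = T.n) {y y' : Fin 4 → ℤ → ℝ}
    (hy : ∀ c < T.n, IntervalD.mem (T.wv y c) (IntervalD.aget Y c))
    (hd : ∀ c < T.n, IntervalD.mem (T.wv y' c - T.wv y c) (IntervalD.aget D c)) :
    ∀ k ≤ K, ∀ c < T.n, IntervalD.mem (T.wv (taylorJet (T.toCertData φ).Qb y' k) c - T.wv (taylorJet (T.toCertData φ).Qb y k) c -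
        T.wv (varJet (T.toCertData φ).Qb y (y' - y) k) c)
      (IntervalD.aget (IntervalD.lget (IntervalD.r2LevelsA T.n QBA prec (IntervalD.jetLevelsA T.n QBA prec Y K)
        (IntervalD.diffJetLevelsA T.n QBA prec (IntervalD.jetLevelsA T.n QBA prec Y K) D K) K) k) c) := by
  intro k hk c hc
  rw [← taylorJet_qBf, ← taylorJet_qBf, ← varJet_qBf]
  exact IntervalD.mem_r2_of_r2LevelsA (T := taylorJet (qBf (T.toCertData φ))) (U := varJet (qBf (T.toCertData φ)))
    (qBf_add_left (T.toCertData φ)) (qBf_add_right (T.toCertData φ)) (fun x z c _ => T.wv_add x z c)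
    (fun x c _ => by rw [taylorJet_zero]) (fun x k c _ => T.wv_taylorJet_qBf_succ x k c) (fun x v c _ => by rw [varJet_zero])
    (fun x v k c _ => T.wv_varJet_qBf_succ x v k c) hQBA prec K hY hD hy hd k hk c hc

end Sound

end CertTables

end Summit.NavierStokesRegularity.NavierStokesRegularity.Theorems.TaylorModelCert
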